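import Literature.ModelTheory.ExponentialFields.CylindricalDecompositionProofs
import Literature.ModelTheory.ExponentialFields.SemialgebraicDimension
import Literature.NumberTheory.Transcendental.KZLogCalculusProofs
import Literature.NumberTheory.Transcendental.KZProductIdeal
import Mathlib.Analysis.Analytic.Constructions
import Mathlib.Analysis.Analytic.Linear

/-!
# `SectorToKernel` (stmt-KontsevichZagierPeriods-10813), line `effective-cube-surjection`, stub F:
# the Nash cylindrical decomposition with straightenable cells

Helper file for the lead's stub `stub_nashCellReductionOf` (skeleton v6).  **Main induction**
(`nash_cad`): given the four ingredient statements A (generic analyticity), B (affine straightening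
of open bands), C (refinement of the base of a cylindrical decomposition), D (cell facts) and the
straightening step (all as hypotheses, landed separately), every finite family of `ℚ`-semialgebraic
subsets of `ℝⁿ` admits an adapted cylindrical decomposition all of whose OPEN BOUNDED cells `S` are
*straightenable*: every representation on `(0,1)^q × S` with analytic integrand is congruent modulo
the Kontsevich–Zagier relations to a `ℤ`-combination of open-cube Nash classes `[(0,1)^{q+n}, J]`.
Induction on `n`: refine Basu–Pollack–Roy's adapted decomposition of `ℝⁿ⁺¹` over the decomposition of
`ℝⁿ` furnished by the induction hypothesis for the family of the base cells and of the non-analyticity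
loci (A) of the sections over open base cells (C); an open bounded cell of the refined decomposition is
an inner band (D) over an open bounded straightenable cell, with walls analytic on it (adaptedness to
the loci), and the straightening step applies.
[Bochnak–Coste–Roy 1998, Prop. 2.9.10; Basu–Pollack–Roy 2006, Thm. 5.6]
-/

noncomputable section

namespace Summit.KontsevichZagierPeriods.FurushoPentagon.SectorToKernel

open Set MeasureTheory Filter Topology
open Literature.ModelTheory.ExponentialFields
open Literature.NumberTheory.Transcendental
open Literature.NumberTheory.Transcendental.KZ

/-! ## Small lemmas -/

/-- A set with empty interior contains no nonempty open set. [folklore] -/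
theorem not_subset_of_interior_eq_empty {X : Type*} [TopologicalSpace X] {U Z : Set X}
    (hU : IsOpen U) (hne : U.Nonempty) (hZ : interior Z = ∅) : ¬ U ⊆ Z := fun h => by
  have : U ⊆ interior Z := interior_maximal h hU
  rw [hZ] at this
  exact hne.ne_empty (subset_eq_empty this rfl)

/-- An open cell of a partition adapted to a set `Z` with empty interior misses `Z`. [folklore] -/
theorem disjoint_of_adapted {n : ℕ} {𝒮 : Finset (Set (Fin n → ℝ))}
    (hpart : Setoid.IsPartition (𝒮 : Set (Set (Fin n → ℝ)))) {S Z : Set (Fin n → ℝ)} (hS : S ∈ 𝒮)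
    (hSo : IsOpen S) (hZ : interior Z = ∅) (hadapt : ∃ 𝒞 ⊆ 𝒮, ⋃₀ (𝒞 : Set (Set (Fin n → ℝ))) = Z) :
    ∀ x ∈ S, x ∉ Z := by
  intro x hx hxZ
  obtain ⟨𝒞, h𝒞, hU⟩ := hadapt
  rw [← hU] at hxZ
  obtain ⟨C, hC, hxC⟩ := mem_sUnion.1 hxZ
  have hC𝒮 : C ∈ 𝒮 := h𝒞 hC
  obtain ⟨T, hT, huniq⟩ := hpart.2 x
  have h1 : C = T := huniq C ⟨by exact_mod_cast hC𝒮, hxC⟩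
  have h2 : S = T := huniq S ⟨by exact_mod_cast hS, hx⟩
  have hSZ : S ⊆ Z := by
    rw [← hU, h2, ← h1]
    exact subset_sUnion_of_mem hC
  have hne : S.Nonempty := ⟨x, hx⟩
  exact not_subset_of_interior_eq_empty hSo hne hZ hSZ

/-- A cell of a partition is nonempty. [folklore] -/
theorem nonempty_of_mem_partition {X : Type*} {𝒮 : Finset (Set X)}
    (hpart : Setoid.IsPartition (𝒮 : Set (Set X))) {S : Set X} (hS : S ∈ 𝒮) : S.Nonempty :=
  nonempty_iff_ne_empty.2 fun h => hpart.1 (by rw [Finset.mem_coe, ← h]; exact hS)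

/-- An open nonempty subset of the cylinder over `S` forces `S` to have nonempty interior
(`Fin.init` is an open map). [folklore] -/
theorem interior_ne_empty_of_open_subset_cylinder {n : ℕ} {T : Set (Fin (n + 1) → ℝ)} {S : Set (Fin n → ℝ)}
    (hTo : IsOpen T) (hTne : T.Nonempty) (hTS : T ⊆ {z | (Fin.init z : Fin n → ℝ) ∈ S}) : interior S ≠ ∅ := by
  have himg : (fun z : Fin (n + 1) → ℝ => (Fin.init z : Fin n → ℝ)) '' T ⊆ S := by
    rintro _ ⟨z, hz, rfl⟩; exact hTS hz
  have hopen : IsOpen ((fun z : Fin (n + 1) → ℝ => (Fin.init z : Fin n → ℝ)) '' T) := isOpenMap_init _ hTo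
  have hne : ((fun z : Fin (n + 1) → ℝ => (Fin.init z : Fin n → ℝ)) '' T).Nonempty := hTne.image _
  intro h
  have := interior_maximal himg hopen
  rw [h] at this
  exact hne.ne_empty (subset_eq_empty this rfl)

/-! ## The main induction -/

/-- **Nash cylindrical decomposition with straightenable open bounded cells.**  Given the ingredients
A (generic analyticity), B (affine straightening of open bands), C (refinement of the base), D (cell facts)
and the straightening step, every finite family of `ℚ`-semialgebraic subsets of `ℝⁿ` has an adapted
cylindrical decomposition all of whose open bounded cells are straightenable at every level `q`.
[cite: BochnakCosteRoy1998, Prop. 2.9.10] [cite: BasuPollackRoy2006, Thm. 5.6] -/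
theorem nash_cad_of
    (hA : ∀ {m : ℕ} {s : Set (Fin m → ℝ)} {f : (Fin m → ℝ) → ℝ},
      IsOpen s → IsSemialgebraicFunOn ℚ s f →
      ∃ Z : Set (Fin m → ℝ), Z ⊆ s ∧ IsSemialgebraic ℚ Z ∧ interior Z = ∅ ∧ IsOpen (s \ Z) ∧
        AnalyticOnNhd ℝ f (s \ Z))
    (hC : ∀ {n : ℕ} (𝒮 𝒮' : Finset (Set (Fin n → ℝ))) (𝒯 : Finset (Set (Fin (n + 1) → ℝ)))
      (l : Set (Fin n → ℝ) → ℕ) (ξ : (S : Set (Fin n → ℝ)) → Fin (l S) → (Fin n → ℝ) → ℝ),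
      Setoid.IsPartition (𝒯 : Set (Set (Fin (n + 1) → ℝ))) → (∀ T ∈ 𝒯, IsSemialgebraic ℚ T) →
      IsCylindricalDecomposition ℚ n 𝒮 →
      (∀ S ∈ 𝒮, ∀ j, ContinuousOn (ξ S j) S) → (∀ S ∈ 𝒮, ∀ j, IsSemialgebraicFunOn ℚ S (ξ S j)) →
      (∀ S ∈ 𝒮, ∀ x ∈ S, StrictMono fun j => ξ S j x) →
      (∀ T, T ∈ 𝒯 ↔ ∃ S ∈ 𝒮, (∃ j, T = graphOver S (ξ S j)) ∨ ∃ j, T = bandOver S (ξ S) j) →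
      IsCylindricalDecomposition ℚ n 𝒮' → (∀ S ∈ 𝒮, ∃ 𝒞 ⊆ 𝒮', ⋃₀ (𝒞 : Set (Set (Fin n → ℝ))) = S) →
      ∃ (𝒯' : Finset (Set (Fin (n + 1) → ℝ))) (l' : Set (Fin n → ℝ) → ℕ)
        (ξ' : (S : Set (Fin n → ℝ)) → Fin (l' S) → (Fin n → ℝ) → ℝ),
        Setoid.IsPartition (𝒯' : Set (Set (Fin (n + 1) → ℝ))) ∧ (∀ T ∈ 𝒯', IsSemialgebraic ℚ T) ∧
        (∀ S ∈ 𝒮', ∀ j, ContinuousOn (ξ' S j) S) ∧ (∀ S ∈ 𝒮', ∀ j, IsSemialgebraicFunOn ℚ S (ξ' S j)) ∧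
        (∀ S ∈ 𝒮', ∀ x ∈ S, StrictMono fun j => ξ' S j x) ∧
        (∀ T, T ∈ 𝒯' ↔ ∃ S ∈ 𝒮', (∃ j, T = graphOver S (ξ' S j)) ∨ ∃ j, T = bandOver S (ξ' S) j) ∧
        (∀ T ∈ 𝒯, ∃ 𝒞 ⊆ 𝒯', ⋃₀ (𝒞 : Set (Set (Fin (n + 1) → ℝ))) = T) ∧
        (∀ S' ∈ 𝒮', ∃ S ∈ 𝒮, S' ⊆ S ∧ ∃ h : l' S' = l S,
          ∀ j, ∀ x ∈ S', ξ' S' j x = ξ S (Fin.cast h j) x))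
    (hD1 : ∀ (n : ℕ) (𝒮 : Finset (Set (Fin n → ℝ))), IsCylindricalDecomposition ℚ n 𝒮 →
        ∀ S ∈ 𝒮, IsOpen S ∨ interior S = ∅)
    (hD2 : ∀ (n l : ℕ) (S : Set (Fin n → ℝ)) (ξ : Fin l → (Fin n → ℝ) → ℝ) (j : Fin (l + 1)),
        S.Nonempty → (∀ x ∈ S, StrictMono fun i => ξ i x) → Bornology.IsBounded (bandOver S ξ j) →
        j ≠ 0 ∧ j ≠ Fin.last l ∧ Bornology.IsBounded S)
    (hStep : ∀ {q n : ℕ} {S' : Set (Fin n → ℝ)}, IsOpen S' → IsSemialgebraic ℚ S' →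
      ∀ {lo hi : (Fin n → ℝ) → ℝ}, AnalyticOnNhd ℝ lo S' → AnalyticOnNhd ℝ hi S' →
      IsSemialgebraicFunOn ℚ S' lo → IsSemialgebraicFunOn ℚ S' hi → (∀ x ∈ S', lo x < hi x) →
      (∀ r : IntegralRep (q + 1 + n),
        r.domain = {z | (∀ i : Fin (q + 1), 0 < z (Fin.castAdd n i) ∧ z (Fin.castAdd n i) < 1) ∧
          (fun j => z (Fin.natAdd (q + 1) j)) ∈ S'} →
        AnalyticOnNhd ℝ r.integrand r.domain →
        ∃ c ∈ AddSubgroup.closure {d : FormalRep | ∃ v : IntegralRep (q + 1 + n),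
            v.domain = {x : Fin (q + 1 + n) → ℝ | ∀ i, 0 < x i ∧ x i < 1} ∧
            AnalyticOnNhd ℝ v.integrand {x : Fin (q + 1 + n) → ℝ | ∀ i, 0 < x i ∧ x i < 1} ∧ d = of v},
          of r - c ∈ relations) →
      ∀ r : IntegralRep (q + (n + 1)),
        r.domain = {z | (∀ i : Fin q, 0 < z (Fin.castAdd (n + 1) i) ∧ z (Fin.castAdd (n + 1) i) < 1) ∧
          (fun j => z (Fin.natAdd q j)) ∈ {w : Fin (n + 1) → ℝ | (Fin.init w : Fin n → ℝ) ∈ S' ∧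
            lo (Fin.init w) < w (Fin.last n) ∧ w (Fin.last n) < hi (Fin.init w)}} →
        AnalyticOnNhd ℝ r.integrand r.domain →
        ∃ c ∈ AddSubgroup.closure {d : FormalRep | ∃ v : IntegralRep (q + (n + 1)),
            v.domain = {x : Fin (q + (n + 1)) → ℝ | ∀ i, 0 < x i ∧ x i < 1} ∧
            AnalyticOnNhd ℝ v.integrand {x : Fin (q + (n + 1)) → ℝ | ∀ i, 0 < x i ∧ x i < 1} ∧ d = of v},
          of r - c ∈ relations) :
    ∀ (n : ℕ) (F : Finset (Set (Fin n → ℝ))), (∀ s ∈ F, IsSemialgebraic ℚ s) →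
      ∃ 𝒮 : Finset (Set (Fin n → ℝ)), IsCylindricalDecomposition ℚ n 𝒮 ∧
        (∀ s ∈ F, ∃ 𝒞 ⊆ 𝒮, ⋃₀ (𝒞 : Set (Set (Fin n → ℝ))) = s) ∧
        ∀ S ∈ 𝒮, IsOpen S → Bornology.IsBounded S → ∀ (q : ℕ) (r : IntegralRep (q + n)),
          r.domain = {z | (∀ i : Fin q, 0 < z (Fin.castAdd n i) ∧ z (Fin.castAdd n i) < 1) ∧
            (fun j => z (Fin.natAdd q j)) ∈ S} →
          AnalyticOnNhd ℝ r.integrand r.domain →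
          ∃ c ∈ AddSubgroup.closure {d : FormalRep | ∃ v : IntegralRep (q + n),
              v.domain = {x : Fin (q + n) → ℝ | ∀ i, 0 < x i ∧ x i < 1} ∧
              AnalyticOnNhd ℝ v.integrand {x : Fin (q + n) → ℝ | ∀ i, 0 < x i ∧ x i < 1} ∧ d = of v},
            of r - c ∈ relations := by
  classical
  intro n
  induction n with
  | zero =>
    intro F hF
    refine ⟨{univ}, isCylindricalDecomposition_zero.2 rfl, fun s _ => ?_, fun S hS _ _ q r hdom han => ?_⟩
    · rcases s.eq_empty_or_nonempty with h | h
      · exact ⟨∅, Finset.empty_subset _, by simp [h]⟩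
      · exact ⟨{univ}, Finset.Subset.refl _, by simp [Subsingleton.eq_univ_of_nonempty h]⟩
    · rw [Finset.mem_singleton] at hS
      subst hS
      have hdom' : r.domain = {x : Fin (q + 0) → ℝ | ∀ i, 0 < x i ∧ x i < 1} := by
        rw [hdom]
        ext z
        simp only [mem_setOf_eq, mem_univ, and_true]
        exact Iff.rfl
      refine ⟨of r, AddSubgroup.subset_closure ⟨r, hdom', hdom' ▸ han, rfl⟩, by simp⟩
  | succ n ih =>
    intro F hF
    -- Basu–Pollack–Roy's adapted decomposition of `ℝⁿ⁺¹` and its stack data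
    obtain ⟨𝒯₀, hcd₀, hadapt₀⟩ := IsSemialgebraic.exists_cylindricalDecomposition_holds (k := ℚ) F hF
    obtain ⟨hpart₀, hsa₀, 𝒮₀, h𝒮₀, l, ξ, hcont, hξsa, hmono, hmem⟩ := hcd₀
    have hpart𝒮₀ := h𝒮₀.isPartition
    have hsa𝒮₀ := h𝒮₀.isSemialgebraic
    -- the non-analyticity loci of the sections over open base cells (A)
    have hZex : ∀ (S : Set (Fin n → ℝ)) (j : Fin (l S)), ∃ Z : Set (Fin n → ℝ),
        IsSemialgebraic ℚ Z ∧ interior Z = ∅ ∧ (S ∈ 𝒮₀ → IsOpen S → AnalyticOnNhd ℝ (ξ S j) (S \ Z)) := by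
      intro S j
      by_cases h : S ∈ 𝒮₀ ∧ IsOpen S
      · obtain ⟨Z, -, hZs, hZi, -, hZa⟩ := hA h.2 (hξsa S h.1 j)
        exact ⟨Z, hZs, hZi, fun _ _ => hZa⟩
      · refine ⟨∅, isSemialgebraic_empty, interior_empty, fun h1 h2 => absurd ⟨h1, h2⟩ h⟩
    choose Z hZs hZi hZa using hZex
    -- the induction hypothesis on the base cells and the loci
    set F' : Finset (Set (Fin n → ℝ)) :=
      𝒮₀ ∪ 𝒮₀.attach.biUnion (fun S => Finset.univ.image fun j : Fin (l S.1) => Z S.1 j) with hF'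
    have hF's : ∀ s ∈ F', IsSemialgebraic ℚ s := by
      intro s hs
      rw [hF', Finset.mem_union] at hs
      rcases hs with hs | hs
      · exact hsa𝒮₀ s hs
      · simp only [Finset.mem_biUnion, Finset.mem_attach, true_and, Finset.mem_image, Finset.mem_univ,
          Subtype.exists] at hs
        obtain ⟨S, -, j, rfl⟩ := hs
        exact hZs S j
    have h𝒮₀F' : ∀ S ∈ 𝒮₀, S ∈ F' := fun S hS => by rw [hF']; exact Finset.mem_union_left _ hS
    have hZF' : ∀ S (hS : S ∈ 𝒮₀) (j : Fin (l S)), Z S j ∈ F' := by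
      intro S hS j
      rw [hF', Finset.mem_union]
      refine Or.inr (Finset.mem_biUnion.2 ⟨⟨S, hS⟩, Finset.mem_attach _ _, ?_⟩)
      exact Finset.mem_image.2 ⟨j, Finset.mem_univ _, rfl⟩
    obtain ⟨𝒮', h𝒮'cd, hadapt', hstr'⟩ := ih F' hF's
    have hpart𝒮' := h𝒮'cd.isPartition
    have hsa𝒮' := h𝒮'cd.isSemialgebraic
    -- refine the stack over `𝒮'` (C)
    obtain ⟨𝒯', l', ξ', hpart', hsa', hcont', hξsa', hmono', hmem', hrefine, hparent⟩ :=
      hC 𝒮₀ 𝒮' 𝒯₀ l ξ hpart₀ hsa₀ h𝒮₀ hcont hξsa hmono hmem h𝒮'cd (fun S hS => hadapt' S (h𝒮₀F' S hS))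
    refine ⟨𝒯', isCylindricalDecomposition_succ.2 ⟨hpart', hsa', 𝒮', h𝒮'cd, l', ξ', hcont', hξsa', hmono', hmem'⟩,
      fun s hs => ?_, fun T' hT' hT'o hT'b q r hdom han => ?_⟩
    · -- adaptedness to `F`
      obtain ⟨𝒞₀, h𝒞₀, hU₀⟩ := hadapt₀ s hs
      choose! 𝒞f h𝒞f hUf using hrefine
      refine ⟨𝒞₀.biUnion 𝒞f, Finset.biUnion_subset.2 fun T hT => h𝒞f T (h𝒞₀ hT), ?_⟩
      rw [← hU₀]
      ext z
      simp only [Finset.coe_biUnion, Finset.mem_coe, mem_sUnion, mem_iUnion, exists_prop]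
      constructor
      · rintro ⟨C, ⟨T, hT, hC⟩, hzC⟩
        refine ⟨T, hT, ?_⟩
        rw [← hUf T (h𝒞₀ hT)]
        exact mem_sUnion.2 ⟨C, hC, hzC⟩
      · rintro ⟨T, hT, hzT⟩
        rw [← hUf T (h𝒞₀ hT)] at hzT
        obtain ⟨C, hC, hzC⟩ := mem_sUnion.1 hzT
        exact ⟨C, ⟨T, hT, hC⟩, hzC⟩
    · -- straightenability of an open bounded cell `T'` of `𝒯'`
      have hT'ne : T'.Nonempty := nonempty_of_mem_partition hpart' hT'
      obtain ⟨S', hS', hT'shape⟩ := (hmem' T').1 hT'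
      have hS'ne : S'.Nonempty := nonempty_of_mem_partition hpart𝒮' hS'
      rcases hT'shape with ⟨j, hj⟩ | ⟨j, hj⟩
      · -- a graph is not open
        exfalso
        have h1 : interior T' = ∅ := by rw [hj]; exact interior_graphOver_eq_empty _ _
        rw [hT'o.interior_eq] at h1
        exact hT'ne.ne_empty h1
      -- an inner band over an open bounded straightenable base cell
      obtain ⟨hj0, hjl, hS'b⟩ := hD2 n (l' S') S' (ξ' S') j hS'ne (hmono' S' hS') (hj ▸ hT'b)
      have hS'o : IsOpen S' := by
        refine (hD1 n 𝒮' h𝒮'cd S' hS').resolve_right ?_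
        refine interior_ne_empty_of_open_subset_cylinder hT'o hT'ne ?_
        rw [hj]
        exact fun z hz => (mem_bandOver_iff.1 hz).1
      -- the walls, their analyticity on `S'`
      set lo : (Fin n → ℝ) → ℝ := ξ' S' (j.pred hj0) with hlo
      set hi : (Fin n → ℝ) → ℝ := ξ' S' (j.castPred hjl) with hhi
      have hT'eq : T' = {w : Fin (n + 1) → ℝ | (Fin.init w : Fin n → ℝ) ∈ S' ∧
          lo (Fin.init w) < w (Fin.last n) ∧ w (Fin.last n) < hi (Fin.init w)} := by
        rw [hj]
        ext w
        rw [mem_bandOver_iff, bandLower_of_ne_zero _ j hj0, bandUpper_of_ne_last _ j hjl,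
          EReal.coe_lt_coe_iff, EReal.coe_lt_coe_iff]
        rfl
      have hlt : ∀ x ∈ S', lo x < hi x := by
        intro x hx
        refine hmono' S' hS' x hx ?_
        rw [Fin.lt_def, Fin.val_pred, Fin.coe_castPred]
        exact Nat.sub_one_lt fun h => hj0 (Fin.ext h)
      obtain ⟨S, hS₀, hS'S, hl, hξ'eq⟩ := hparent S' hS'
      have hSo : IsOpen S := by
        refine (hD1 n 𝒮₀ h𝒮₀ S hS₀).resolve_right fun h => ?_
        have : S' ⊆ interior S := interior_maximal hS'S hS'o
        rw [h] at this
        exact hS'ne.ne_empty (subset_eq_empty this rfl)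
      have han_wall : ∀ i : Fin (l' S'), AnalyticOnNhd ℝ (ξ' S' i) S' := by
        intro i x hx
        set i₀ : Fin (l S) := Fin.cast hl i with hi₀
        have hZ : ∀ y ∈ S', y ∉ Z S i₀ :=
          disjoint_of_adapted hpart𝒮' hS' hS'o (hZi S i₀) (hadapt' _ (hZF' S hS₀ i₀))
        have h1 : AnalyticAt ℝ (ξ S i₀) x := hZa S i₀ hS₀ hSo x ⟨hS'S hx, hZ x hx⟩
        refine h1.congr ?_
        filter_upwards [hS'o.mem_nhds hx] with y hy
        exact (hξ'eq i y hy).symm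
      have hstep := hStep (q := q) hS'o (hsa𝒮' S' hS') (han_wall _) (han_wall _)
        (hξsa' S' hS' _) (hξsa' S' hS' _) hlt (hstr' S' hS' hS'o hS'b (q + 1)) r
        (by rw [hdom, hT'eq]) han
      exact hstep


/-- **Nash cylindrical decomposition with straightenable open bounded cells** (registered form: all
hypotheses after the colon).  See `nash_cad_of`. [cite: BochnakCosteRoy1998, Prop. 2.9.10] [cite: BasuPollackRoy2006, Thm. 5.6] -/
theorem nash_cad :
    (∀ {m : ℕ} {s : Set (Fin m → ℝ)} {f : (Fin m → ℝ) → ℝ},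
      IsOpen s → IsSemialgebraicFunOn ℚ s f →
      ∃ Z : Set (Fin m → ℝ), Z ⊆ s ∧ IsSemialgebraic ℚ Z ∧ interior Z = ∅ ∧ IsOpen (s \ Z) ∧
        AnalyticOnNhd ℝ f (s \ Z)) →
    (∀ {n : ℕ} (𝒮 𝒮' : Finset (Set (Fin n → ℝ))) (𝒯 : Finset (Set (Fin (n + 1) → ℝ)))
      (l : Set (Fin n → ℝ) → ℕ) (ξ : (S : Set (Fin n → ℝ)) → Fin (l S) → (Fin n → ℝ) → ℝ),
      Setoid.IsPartition (𝒯 : Set (Set (Fin (n + 1) → ℝ))) → (∀ T ∈ 𝒯, IsSemialgebraic ℚ T) →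
      IsCylindricalDecomposition ℚ n 𝒮 →
      (∀ S ∈ 𝒮, ∀ j, ContinuousOn (ξ S j) S) → (∀ S ∈ 𝒮, ∀ j, IsSemialgebraicFunOn ℚ S (ξ S j)) →
      (∀ S ∈ 𝒮, ∀ x ∈ S, StrictMono fun j => ξ S j x) →
      (∀ T, T ∈ 𝒯 ↔ ∃ S ∈ 𝒮, (∃ j, T = graphOver S (ξ S j)) ∨ ∃ j, T = bandOver S (ξ S) j) →
      IsCylindricalDecomposition ℚ n 𝒮' → (∀ S ∈ 𝒮, ∃ 𝒞 ⊆ 𝒮', ⋃₀ (𝒞 : Set (Set (Fin n → ℝ))) = S) →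
      ∃ (𝒯' : Finset (Set (Fin (n + 1) → ℝ))) (l' : Set (Fin n → ℝ) → ℕ)
        (ξ' : (S : Set (Fin n → ℝ)) → Fin (l' S) → (Fin n → ℝ) → ℝ),
        Setoid.IsPartition (𝒯' : Set (Set (Fin (n + 1) → ℝ))) ∧ (∀ T ∈ 𝒯', IsSemialgebraic ℚ T) ∧
        (∀ S ∈ 𝒮', ∀ j, ContinuousOn (ξ' S j) S) ∧ (∀ S ∈ 𝒮', ∀ j, IsSemialgebraicFunOn ℚ S (ξ' S j)) ∧
        (∀ S ∈ 𝒮', ∀ x ∈ S, StrictMono fun j => ξ' S j x) ∧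
        (∀ T, T ∈ 𝒯' ↔ ∃ S ∈ 𝒮', (∃ j, T = graphOver S (ξ' S j)) ∨ ∃ j, T = bandOver S (ξ' S) j) ∧
        (∀ T ∈ 𝒯, ∃ 𝒞 ⊆ 𝒯', ⋃₀ (𝒞 : Set (Set (Fin (n + 1) → ℝ))) = T) ∧
        (∀ S' ∈ 𝒮', ∃ S ∈ 𝒮, S' ⊆ S ∧ ∃ h : l' S' = l S,
          ∀ j, ∀ x ∈ S', ξ' S' j x = ξ S (Fin.cast h j) x)) →
    (∀ (n : ℕ) (𝒮 : Finset (Set (Fin n → ℝ))), IsCylindricalDecomposition ℚ n 𝒮 →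
        ∀ S ∈ 𝒮, IsOpen S ∨ interior S = ∅) →
    (∀ (n l : ℕ) (S : Set (Fin n → ℝ)) (ξ : Fin l → (Fin n → ℝ) → ℝ) (j : Fin (l + 1)),
        S.Nonempty → (∀ x ∈ S, StrictMono fun i => ξ i x) → Bornology.IsBounded (bandOver S ξ j) →
        j ≠ 0 ∧ j ≠ Fin.last l ∧ Bornology.IsBounded S) →
    (∀ {q n : ℕ} {S' : Set (Fin n → ℝ)}, IsOpen S' → IsSemialgebraic ℚ S' →
      ∀ {lo hi : (Fin n → ℝ) → ℝ}, AnalyticOnNhd ℝ lo S' → AnalyticOnNhd ℝ hi S' →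
      IsSemialgebraicFunOn ℚ S' lo → IsSemialgebraicFunOn ℚ S' hi → (∀ x ∈ S', lo x < hi x) →
      (∀ r : IntegralRep (q + 1 + n),
        r.domain = {z | (∀ i : Fin (q + 1), 0 < z (Fin.castAdd n i) ∧ z (Fin.castAdd n i) < 1) ∧
          (fun j => z (Fin.natAdd (q + 1) j)) ∈ S'} →
        AnalyticOnNhd ℝ r.integrand r.domain →
        ∃ c ∈ AddSubgroup.closure {d : FormalRep | ∃ v : IntegralRep (q + 1 + n),
            v.domain = {x : Fin (q + 1 + n) → ℝ | ∀ i, 0 < x i ∧ x i < 1} ∧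
            AnalyticOnNhd ℝ v.integrand {x : Fin (q + 1 + n) → ℝ | ∀ i, 0 < x i ∧ x i < 1} ∧ d = of v},
          of r - c ∈ relations) →
      ∀ r : IntegralRep (q + (n + 1)),
        r.domain = {z | (∀ i : Fin q, 0 < z (Fin.castAdd (n + 1) i) ∧ z (Fin.castAdd (n + 1) i) < 1) ∧
          (fun j => z (Fin.natAdd q j)) ∈ {w : Fin (n + 1) → ℝ | (Fin.init w : Fin n → ℝ) ∈ S' ∧
            lo (Fin.init w) < w (Fin.last n) ∧ w (Fin.last n) < hi (Fin.init w)}} →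
        AnalyticOnNhd ℝ r.integrand r.domain →
        ∃ c ∈ AddSubgroup.closure {d : FormalRep | ∃ v : IntegralRep (q + (n + 1)),
            v.domain = {x : Fin (q + (n + 1)) → ℝ | ∀ i, 0 < x i ∧ x i < 1} ∧
            AnalyticOnNhd ℝ v.integrand {x : Fin (q + (n + 1)) → ℝ | ∀ i, 0 < x i ∧ x i < 1} ∧ d = of v},
          of r - c ∈ relations) →
    ∀ (n : ℕ) (F : Finset (Set (Fin n → ℝ))), (∀ s ∈ F, IsSemialgebraic ℚ s) →
      ∃ 𝒮 : Finset (Set (Fin n → ℝ)), IsCylindricalDecomposition ℚ n 𝒮 ∧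
        (∀ s ∈ F, ∃ 𝒞 ⊆ 𝒮, ⋃₀ (𝒞 : Set (Set (Fin n → ℝ))) = s) ∧
        ∀ S ∈ 𝒮, IsOpen S → Bornology.IsBounded S → ∀ (q : ℕ) (r : IntegralRep (q + n)),
          r.domain = {z | (∀ i : Fin q, 0 < z (Fin.castAdd n i) ∧ z (Fin.castAdd n i) < 1) ∧
            (fun j => z (Fin.natAdd q j)) ∈ S} →
          AnalyticOnNhd ℝ r.integrand r.domain →
          ∃ c ∈ AddSubgroup.closure {d : FormalRep | ∃ v : IntegralRep (q + n),
              v.domain = {x : Fin (q + n) → ℝ | ∀ i, 0 < x i ∧ x i < 1} ∧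
              AnalyticOnNhd ℝ v.integrand {x : Fin (q + n) → ℝ | ∀ i, 0 < x i ∧ x i < 1} ∧ d = of v},
            of r - c ∈ relations :=
  fun hA hC hD1 hD2 hStep => nash_cad_of hA hC hD1 hD2 hStep

end Summit.KontsevichZagierPeriods.FurushoPentagon.SectorToKernel
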